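/-
Copyright (c) 2026 the pub-hodgecm-mathlib formalisation cell (harness21).  Prover seat hodgecm-mathlib-LH4-p12 (g7), req620 Track A «(D-RAM) FOUR-FRAME», line LH4
(STAGE-1b tier-0 regular row, (L-sq): THE LABELLED SIGNED κ-STAGE B₀ OF THE SQUARE LAW AND THE ED. 5 STUB `stub_law_sq` MODULO THE ONE ARITHMETIC PROP `SqLabelledBoxSum`
(★ p859958; proof LH4-p10 (g6) `SqLabelledBoxSum_holds`).  ★ p857128's body VERBATIM over the labelled trunk (d) PART 4.)  2026-09-04.
-/
import Summits.HodgeConjecture.HodgeConjecture.Theorems.F0P3cDyRamSqLabelledTrunkOfBoxSum                   -- (d) PART 4 (this seat): the labelled trunk modulo `SqLabelledBoxSum`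
import Summits.HodgeConjecture.HodgeConjecture.Theorems.F0P3cDyRamSqKappaSignCount2TypeZeroOfLabelledTrunk    -- ★ p859650 (this seat): brings ★ p857128's tools + ★ p859612 (S2a-κ HEAD) + ★ p859556 (S2c)
import Summits.HodgeConjecture.HodgeConjecture.Theorems.F0P3cDyRamSqDatumDerivedFence                       -- ★ p859917 (this seat): the fence from the root guards
import Summits.HodgeConjecture.HodgeConjecture.Theorems.F0P3cDyRamStageOneBDefs                              -- ★ p859562 DEFS №5: `amplCs`, `csOfRecord`, `mstarOfRecord`, `SqKappaSignLawAtS2`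
import Summits.HodgeConjecture.HodgeConjecture.Theorems.F0P3cDyRamSqLabelledKappaBoxSum                         -- ★ p860095 (LH4-p10 (g6)): `SqLabelledBoxSum_holds` — the truncated box-sum PROVED
import HarnessLib

/-!
# Crux `H413`, line LH4 «(D-RAM) FOUR-FRAME» — (L-sq) THE SQUARE κ-SIGN LAW OF RECORD MODULO `SqLabelledBoxSum`

* §1 `kappaSignCount2_typeZero_sq_of_boxSum (hbox : SqLabelledBoxSum)` — the labelled signed κ-Stage B₀ of the square law = the binder `hBκS0sq` of ★ p859556 at
  `Ω := omegaR`, `lb := mstarOfRecord`, `A := amplCs`, token for token: ★ p857128's body with the trunk line = (d) PART 4 `labelledTrunk_sq_of_boxSum hbox …` (fence from ★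
  p859917 `depths_ge_of_rootGuard`, the root guards being binders here), dead axis `B ≤ cs` ⇒ `ampl = 0`, alive axis ⇒ the ★ (C1) token tables unchanged.
* §2 `sqKappaSignModelSum2_omegaR_of_boxSum` — TIE through ★ p859612 `sqKappaSignModelSum2_of_labelledKappaStageBZero omegaR mstarOfRecord amplCs`.
* §3 `fencedSqKappaSign_ofRecord_of_boxSum` — the ED. 5 law slot: ★ p859556 `fencedSqKappaSignSlot_of_labelledKappaStageB omegaR mstarOfRecord amplCs` fed with ★ p859612's
  (S2a-κ) HEAD and §1 — the sentence of `stub_law_sq` up to the definitional unfolding of `DyadicFence ∕ SqKappaSignLawAtS2` (the pen's pay line), MODULO `hbox`.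

HONEST LABEL: helper lane (`--supports stmt-HodgeConjecture-24833`), count-neutral; §1–§2 conditional on `SqLabelledBoxSum`, §3 UNCONDITIONAL via ★ p860095 `SqLabelledBoxSum_holds`
(LH4-p10 (g6)) — the HEAD `dyadicFence_sqKappaSignLawAtS2_ofRecord` is the ED. 5 stub `stub_law_sq`'s sentence; pays the tier-0 law stub only when the pen writes the pay line;
HC_CM is proved only modulo the 7 printed citations (2 remaining named inputs: hLiu418 = stmt-HodgeConjecture-24832, h413 = stmt-HodgeConjecture-24833) until rung 0 closes.

## References (NEVER `[KR2]`)
* [Kottwitz1986BaseChangeUnits] R. E. Kottwitz, *Base change for unit elements of Hecke algebras*, Compositio Math. 60 (1986), §1 pp. 240–241.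
* [Rogawski1990] J. D. Rogawski, *Automorphic Representations of Unitary Groups in Three Variables*, Ann. of Math. Stud. 123 (1990), §4.9 Prop. 4.9.1 (a) p. 55, §4.10 p. 58.
* [LanglandsShelstad1987] R. P. Langlands, D. Shelstad, *On the definition of transfer factors*, Math. Ann. 278 (1987), §3.
* [Serre1979] J.-P. Serre, *Local Fields*, GTM 67 (1979), Ch. V §3 Prop. 5, Cor. 3.
-/

set_option autoImplicit false

noncomputable section

namespace Summit.HodgeConjecture.HodgeConjecture.Cruxes.H413.F0P3cDyRamSqKappaSignLawOfBoxSum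

open Literature.NumberTheory.Automorphic Literature.NumberTheory.Automorphic.HermitianLattice
open Literature.NumberTheory.Automorphic.UnitaryLatticeTree Literature.NumberTheory.Automorphic.UnitaryThreeFourFrame
open Literature.NumberTheory.LocalFields Literature.NumberTheory.LocalFields.WildQuadraticDatum
open Summit.HodgeConjecture.HodgeConjecture.Cruxes.H413.F0P3cDyRamFourFrameLawDefsR (shiftR)
open Summit.HodgeConjecture.HodgeConjecture.Cruxes.H413.F0P3cDyRamFourFrameLawDefsR2 (OmegaSchedule)
open Summit.HodgeConjecture.HodgeConjecture.Cruxes.H413.F0P3cDyRamFourFrameCensusDefs (LatticeInLevel)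
open Summit.HodgeConjecture.HodgeConjecture.Cruxes.H413.F0P3cDyRamDiagonalTorusDefs (normalisedStableLattices stabiliserWeight IsDualisableLattice)
open Summit.HodgeConjecture.HodgeConjecture.Cruxes.H413.F0P3cDyRamDiagonalKappaCountDefs (kappaCount)
open Summit.HodgeConjecture.HodgeConjecture.Cruxes.H413.F0P3cDyRamOmegaRDefs (omegaR)
open Summit.HodgeConjecture.HodgeConjecture.Cruxes.H413.F0P3cDyRamKappaAssemblyTools (exists_glue_witness)
open Summit.HodgeConjecture.HodgeConjecture.Cruxes.H413.F0P3cDyRamDiagonalPermutation (isElementDatum_swap isElementDatum_rescale)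
open Summit.HodgeConjecture.HodgeConjecture.Cruxes.H413.F0P3cDyRamElementDatumParity (isoceles_of_isElementDatum)
open Summit.HodgeConjecture.HodgeConjecture.Cruxes.H413.F0P3cDyRamDiagonalGlueSignDefs (IsGlueRep glueSign)
open Summit.HodgeConjecture.HodgeConjecture.Cruxes.H413.F0P3cDyRamDiagonalGlueSignTokenRotations
open Summit.HodgeConjecture.HodgeConjecture.Cruxes.H413.F0P3cDyRamLabelledKappaOrbitCountZero (sqKappaSignModelSum2_of_labelledKappaStageBZero)
open scoped Valued WithZero Matrix MatrixGroups
open Summit.HodgeConjecture.HodgeConjecture.Cruxes.H413.F0P3cDyRamDiagonalGlueSignEval (ampl_eq_zero_of_nonpos)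
open Summit.HodgeConjecture.HodgeConjecture.Cruxes.H413.F0P3cDyRamSqDatumDerivedFence (depths_ge_of_rootGuard)
open Summit.HodgeConjecture.HodgeConjecture.Cruxes.H413.F0P3cDyRamSqLabelledTrunkOfBoxSum (labelledTrunk_sq_of_boxSum)
open Summit.HodgeConjecture.HodgeConjecture.Cruxes.H413.F0P3cDyRamSqKappaSignModelSumOfLabelledStageB (fencedSqKappaSignSlot_of_labelledKappaStageB)
open Summit.HodgeConjecture.HodgeConjecture.Cruxes.H413.F0P3cDyRamFourFramePieces (mstarOfRecord)
open Summit.HodgeConjecture.HodgeConjecture.Cruxes.H413.F0P3cDyRamStageOneBDefs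
open Summit.HodgeConjecture.HodgeConjecture.Cruxes.H413 (F0P3cDyRamLabelledKappaOrbitCountZero.cast_sum_signChar_mul_ncard_inLevel_eq_eight_mul_finsum_kappaCount_zero)
open Summit.HodgeConjecture.HodgeConjecture.Cruxes.H413.F0P3cDyRamFourFrameLawDefs (DyadicFence)

/-! ## §1  The labelled signed κ-Stage B₀ of the square law modulo `SqLabelledBoxSum` -/

/-- **(S2b-κS) MODULO THE BOX-SUM — THE LABELLED SIGNED κ-WEIGHTED TYPE-0 CENSUS LAW OF THE SQUARE DATUM.**  GIVEN `SqLabelledBoxSum`: for every wild datum, skew `δ ≠ 0`,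
norm-one roots `a, b` under the root guards, square element datum `(a², b²; n₁, n₂, n₃)` at the depth of record, `T = diag(a², b², 1)`, `2k + d = Σn + 2`, slot `i`,
`2B = nᵢ − d + 2 − 2·shiftR d t`:  `Σᶠ_{M ∈ 𝓛₀(T), dualisable, diag((a²−1)², (b²−1)², 0)·M ⊆ ϖ^{m*(d)}·M} κ₀,ᵢ(M)·w(M) = omegaR_i·(ω(−1),ω(−1),1)_i·baseSign_i·ω(fPartProd δ (a,b,1) i)·amplCs(q,d,t,k,B)∕4`
— the binder `hBκS0sq` of ★ p859556 at `(Ω, lb, A) := (omegaR, mstarOfRecord, amplCs)`, token for token.  [cite: Kottwitz1986BaseChangeUnits, §1 pp. 240–241]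
[cite: Rogawski1990, §4.9 Prop. 4.9.1 (a) p. 55; §4.10 p. 58] [cite: LanglandsShelstad1987, §3] [cite: Serre1979, Ch. V §3 Prop. 5, Cor. 3] -/
theorem kappaSignCount2_typeZero_sq_of_boxSum (hbox : Literature.Uncategorized.SqLabelledBoxSum) :
    ∀ {K : Type} [Field K] [Valued K ℤᵐ⁰] [CompleteSpace K] [Fintype 𝓀[K]] {σ : K →+* K} {ϖ : K} {d t : ℕ}, IsRamifiedQuadraticDatum σ ϖ d t →
      Valued.v (2 : K) < 1 → ∀ {δ : K}, σ δ = -δ → δ ≠ 0 →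
      ∀ {a b : K}, a * σ a = 1 → b * σ b = 1 → Valued.v (a - 1) < Valued.v (2 : K) → Valued.v (b - 1) < Valued.v (2 : K) →
      ∀ {n₁ n₂ n₃ : ℕ}, IsElementDatum σ ϖ (depthOfRecord d) (a * a) (b * b) n₁ n₂ n₃ →
      ∀ (T : GL (Fin 3) K), (T : Matrix (Fin 3) (Fin 3) K) = Matrix.diagonal ![a * a, b * b, 1] → ∀ (k : ℕ), 2 * k + d = n₁ + n₂ + n₃ + 2 →
      ∀ (i : Fin 3) (B : ℤ), 2 * B = ((![n₁, n₂, n₃] : Fin 3 → ℕ) i : ℤ) - d + 2 - 2 * shiftR d t →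
        ∑ᶠ M ∈ {M : Submodule 𝒪[K] (Fin 3 → K) | M ∈ normalisedStableLattices T ∧ IsDualisableLattice σ ϖ M ∧
            LatticeInLevel ϖ (mstarOfRecord d) (Matrix.diagonal ![(a * a - 1) * (a * a - 1), (b * b - 1) * (b * b - 1), 0]) M},
            (kappaCount σ ϖ 0 i M : ℚ) * stabiliserWeight σ M =
          ((omegaR K σ ϖ d a b i * ((![normSign σ (-1 : K), normSign σ (-1 : K), 1] : Fin 3 → ℤ) i *
            (baseSign σ i * normSign σ (fPartProd δ ![a, b, 1] i))) : ℤ) : ℚ) * amplCs (Fintype.card 𝓀[K]) d t k B / 4 := by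
  intro K _ _ _ _ σ ϖ d t hD h2 δ hδ hδ0 a b ha hb ha2 hb2 n₁ n₂ n₃ hE T hT k hk i B hB
  obtain ⟨-, hvσ, -, -, -, hd1, -⟩ := id hD
  have hN₀ : d ≤ depthOfRecord d := by unfold depthOfRecord; split_ifs <;> omega
  obtain ⟨-, -, -, -, -, h₁, h₂, h₃, -, -, -⟩ := id hE
  -- (1) the three glue witnesses (foot 0 ∕ H corner, the swapped foot, the rescaled foot)
  obtain ⟨f₀, hσf₀, hf₀⟩ := exists_glue_witness hD hE hN₀
  obtain ⟨f₁, hσf₁, hf₁⟩ := exists_glue_witness hD (isElementDatum_swap hE) hN₀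
  obtain ⟨f₂, hσf₂, hf₂⟩ := exists_glue_witness hD (isElementDatum_rescale hvσ hE) hN₀
  -- (2) the LABELLED trunk (hypothesis): the labelled sum IS the witness token times the labelled amplitude
  have hfence := depths_ge_of_rootGuard hD ha2 hb2 hE
  have hℓ : mstarOfRecord d + 1 = d % 2 + 2 * d := by unfold mstarOfRecord; omega
  rw [labelledTrunk_sq_of_boxSum hbox hD h2 hE hfence hℓ T hT k hk i B hB hσf₀ hσf₁ hσf₂ hf₀ hf₁ hf₂]
  simp only [amplCs, csOfRecord]
  by_cases hB1 : 1 ≤ B - (((d + 1) / 2 : ℕ) : ℤ)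
  · -- (4) ALIVE axis: the witness token is the law token
    have hshift : shiftR d t = ((d - d % 2 : ℕ) : ℤ) := rfl
    rw [hshift] at hB
    have hiso := isoceles_of_isElementDatum hD hE
    have htok :
        (if n₁ = n₂ ∧ n₂ = n₃ then ((((![normSign σ (-(1 + f₀)), normSign σ f₀ * normSign σ (-(1 + f₀)), normSign σ f₀] : Fin 3 → ℤ) i : ℤ) : ℚ))
        else if n₂ = n₃ then (![![(normSign σ (-1 : K) : ℚ) * normSign σ (1 + f₀), (normSign σ (-1 : K) : ℚ) * normSign σ f₀ * normSign σ (1 + f₀), (normSign σ f₀ : ℚ)],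
           ![(normSign σ (-1 : K) : ℚ) * normSign σ f₁ * normSign σ (1 + f₁), (normSign σ (-1 : K) : ℚ) * normSign σ (1 + f₁), (normSign σ f₁ : ℚ)],
           ![(normSign σ f₂ : ℚ), (normSign σ (-1 : K) : ℚ) * normSign σ f₂ * normSign σ (1 + f₂), (normSign σ (-1 : K) : ℚ) * normSign σ (1 + f₂)]] : Fin 3 → Fin 3 → ℚ) 0 i
        else if n₁ = n₃ then (![![(normSign σ (-1 : K) : ℚ) * normSign σ (1 + f₀), (normSign σ (-1 : K) : ℚ) * normSign σ f₀ * normSign σ (1 + f₀), (normSign σ f₀ : ℚ)],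
           ![(normSign σ (-1 : K) : ℚ) * normSign σ f₁ * normSign σ (1 + f₁), (normSign σ (-1 : K) : ℚ) * normSign σ (1 + f₁), (normSign σ f₁ : ℚ)],
           ![(normSign σ f₂ : ℚ), (normSign σ (-1 : K) : ℚ) * normSign σ f₂ * normSign σ (1 + f₂), (normSign σ (-1 : K) : ℚ) * normSign σ (1 + f₂)]] : Fin 3 → Fin 3 → ℚ) 1 i
        else (![![(normSign σ (-1 : K) : ℚ) * normSign σ (1 + f₀), (normSign σ (-1 : K) : ℚ) * normSign σ f₀ * normSign σ (1 + f₀), (normSign σ f₀ : ℚ)],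
           ![(normSign σ (-1 : K) : ℚ) * normSign σ f₁ * normSign σ (1 + f₁), (normSign σ (-1 : K) : ℚ) * normSign σ (1 + f₁), (normSign σ f₁ : ℚ)],
           ![(normSign σ f₂ : ℚ), (normSign σ (-1 : K) : ℚ) * normSign σ f₂ * normSign σ (1 + f₂), (normSign σ (-1 : K) : ℚ) * normSign σ (1 + f₂)]] : Fin 3 → Fin 3 → ℚ) 2 i) =
          ((omegaR K σ ϖ d a b i * ((![normSign σ (-1 : K), normSign σ (-1 : K), 1] : Fin 3 → ℤ) i *
            (baseSign σ i * normSign σ (fPartProd δ ![a, b, 1] i))) : ℤ) : ℚ) := by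
      by_cases h123 : n₁ = n₂ ∧ n₂ = n₃
      · -- the H corner: all three depths equal `n₁`
        rw [if_pos h123]
        obtain ⟨h12, h23⟩ := h123
        have h₂' : Valued.v (a * a - 1) = Valued.v ϖ ^ n₁ := by rw [h12]; exact h₂
        have h₃' : Valued.v (a * a - b * b) = Valued.v ϖ ^ n₁ := by rw [h12, h23]; exact h₃
        have hni : (((![n₁, n₂, n₃] : Fin 3 → ℕ) i : ℕ) : ℤ) = n₁ := by fin_cases i <;> simp [h12, h23]
        rw [hni] at hB
        exact hCorner_slot hD hδ hδ0 ha hb h₁ h₂' h₃' hσf₀ (hf₀ h23 (by omega)) (by omega) i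
      · rw [if_neg h123]
        by_cases h23 : n₂ = n₃
        · -- foot 0: `n₂ = n₃ < n₁`
          rw [if_pos h23]
          have h21 : n₂ ≤ n₁ := by omega
          fin_cases i
          · simp only [Fin.zero_eta, Fin.isValue, Matrix.cons_val_zero] at hB ⊢
            exact footZero_slot_zero hD hδ hδ0 ha hb h₁ h₂ h₃ h23 hσf₀ (hf₀ h23 h21) (by omega)
          · simp only [Fin.mk_one, Fin.isValue, Matrix.cons_val_one, Matrix.cons_val_zero] at hB ⊢
            exact footZero_slot_one hD hδ hδ0 ha hb h₁ h₂ h₃ h23 h21 hσf₀ (hf₀ h23 h21) (by omega)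
          · simp only [Fin.reduceFinMk, Fin.isValue, Matrix.cons_val_two, Matrix.cons_val_zero, Matrix.tail_cons, Matrix.head_cons] at hB ⊢
            exact footZero_slot_two hD hδ hδ0 ha hb h₁ h₂ h₃ h21 hσf₀ (hf₀ h23 h21) (by omega)
        · rw [if_neg h23]
          by_cases h13 : n₁ = n₃
          · -- foot 1: `n₁ = n₃ < n₂`, the swapped datum `(b, a)`
            rw [if_pos h13]
            have h12 : n₁ ≤ n₂ := by omega
            fin_cases i
            · simp only [Fin.zero_eta, Fin.isValue, Matrix.cons_val_zero, Matrix.cons_val_one] at hB ⊢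
              exact footOne_slot_zero hD hδ hδ0 ha hb h₁ h₂ h₃ h13 h12 hσf₁ (hf₁ h13 h12) (by omega)
            · simp only [Fin.mk_one, Fin.isValue, Matrix.cons_val_one, Matrix.cons_val_zero] at hB ⊢
              exact footOne_slot_one hD hδ hδ0 ha hb h₁ h₂ h₃ h13 hσf₁ (hf₁ h13 h12) (by omega)
            · simp only [Fin.reduceFinMk, Fin.isValue, Matrix.cons_val_two, Matrix.cons_val_one, Matrix.cons_val_zero, Matrix.tail_cons, Matrix.head_cons] at hB ⊢
              exact footOne_slot_two hD hδ hδ0 ha hb h₁ h₂ h₃ h12 hσf₁ (hf₁ h13 h12) (by omega)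
          · -- foot 2: `n₁ = n₂ < n₃`, the rescaled datum `(a⁻¹, b·a⁻¹)`
            rw [if_neg h13]
            have h12 : n₁ = n₂ := by omega
            have h23' : n₂ ≤ n₃ := by omega
            fin_cases i
            · simp only [Fin.zero_eta, Fin.isValue, Matrix.cons_val_zero, Matrix.cons_val_two, Matrix.tail_cons, Matrix.head_cons] at hB ⊢
              exact footTwo_slot_zero hD hδ hδ0 ha hb h₁ h₂ h₃ h23' hσf₂ (hf₂ h12.symm h23') (by omega)
            · simp only [Fin.mk_one, Fin.isValue, Matrix.cons_val_one, Matrix.cons_val_two, Matrix.cons_val_zero, Matrix.tail_cons, Matrix.head_cons] at hB ⊢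
              exact footTwo_slot_one hD hδ hδ0 ha hb h₁ h₂ h₃ h12 h23' hσf₂ (hf₂ h12.symm h23') (by omega)
            · simp only [Fin.reduceFinMk, Fin.isValue, Matrix.cons_val_two, Matrix.tail_cons, Matrix.head_cons] at hB ⊢
              exact footTwo_slot_two hD hδ hδ0 ha hb h₁ h₂ h₃ h12 hσf₂ (hf₂ h12.symm h23') (by omega)
    rw [htok, mul_div_assoc]
  · -- (3) DEAD axis: the amplitude vanishes on both sides
    have hB0 : B - (((d + 1) / 2 : ℕ) : ℤ) ≤ 0 := by omega
    rw [ampl_eq_zero_of_nonpos (Fintype.card_pos_iff.2 ⟨0⟩) _ hB0, zero_div, mul_zero, mul_zero, zero_div]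

/-! ## §2  The ED. 5 law slot of record modulo `SqLabelledBoxSum` -/

/-- **THE FENCED SQUARE κ-SIGN LAW SLOT OF RECORD, MODULO THE BOX-SUM**: ★ p859556 `fencedSqKappaSignSlot_of_labelledKappaStageB omegaR mstarOfRecord amplCs` fed with the
★ (S2a-κ) HEAD ★ p859612 `cast_sum_signChar_mul_ncard_inLevel_eq_eight_mul_finsum_kappaCount_zero` and §1 — for every wild datum, four-frame family, skew `δ`, roots `a, b` under
the root guards, square element datum at the depth of record, frame elements `Γ_b = frameElt σ f b a² b²`, `2k + d = Σn + 2`, slot `i`, `2B = nᵢ − d + 2 − 2·shiftR d t`: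
`Σ_b κᵢ(b)·#{M : type 0, Γ_b·M = M, (Γ_b − 1)²M ⊆ ϖ^{m*(d)}M} = omegaR_i · baseSign_i · ω(fPartProd δ (a,b,1) i) · amplCs(q, d, t, k, B)` — the sentence behind ED. 5's
`stub_law_sq` (`DyadicFence (SqKappaSignLawAtS2 shiftR omegaR depthOfRecord csOfRecord σ ϖ d t)` up to unfolding), CONDITIONAL on `SqLabelledBoxSum`.
[cite: Kottwitz1986BaseChangeUnits, §1 pp. 240–241] [cite: Rogawski1990, §4.9 Prop. 4.9.1 (a) p. 55; §4.10 p. 58] [cite: LanglandsShelstad1987, §3] -/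
theorem fencedSqKappaSign_ofRecord_of_boxSum (hbox : Literature.Uncategorized.SqLabelledBoxSum)
    {K : Type} [Field K] [Valued K ℤᵐ⁰] [CompleteSpace K] [Fintype 𝓀[K]] (σ : K →+* K) (ϖ : K) (d t : ℕ) :
    Valued.v (2 : K) < 1 → IsRamifiedQuadraticDatum σ ϖ d t →
      ∀ (f : Fin 4 → Fin 3 → (Fin 3 → K)), IsFourFrameFamily σ f →
      ∀ (δ : K), σ δ = -δ → δ ≠ 0 →
      ∀ (a b : K), a * σ a = 1 → b * σ b = 1 → Valued.v (a - 1) < Valued.v (2 : K) → Valued.v (b - 1) < Valued.v (2 : K) →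
      ∀ (n₁ n₂ n₃ : ℕ), IsElementDatum σ ϖ (depthOfRecord d) (a * a) (b * b) n₁ n₂ n₃ →
      ∀ (Γ : Fin 4 → GL (Fin 3) K), (∀ b', (Γ b' : Matrix (Fin 3) (Fin 3) K) = frameElt σ f b' (a * a) (b * b)) →
      ∀ (k : ℕ), 2 * k + d = n₁ + n₂ + n₃ + 2 →
      ∀ (i : Fin 3) (B : ℤ), 2 * B = ((![n₁, n₂, n₃] : Fin 3 → ℕ) i : ℤ) - d + 2 - 2 * shiftR d t →
        ((∑ b' : Fin 4, kappaChar i b' * ({M : Submodule (Valued.integer K) (Fin 3 → K) | IsVertexLattice σ ϖ ((StdForm.antidiagonal 3).over K) 0 M ∧ mapGL (Γ b') M = M ∧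
            LatticeInLevel ϖ (mstarOfRecord d) (((Γ b' : Matrix (Fin 3) (Fin 3) K) - 1) * ((Γ b' : Matrix (Fin 3) (Fin 3) K) - 1)) M}.ncard : ℤ) : ℤ) : ℚ) =
          (omegaR K σ ϖ d a b i * (baseSign σ i * normSign σ (fPartProd δ ![a, b, 1] i)) : ℤ) * amplCs (Fintype.card 𝓀[K]) d t k B :=
  fencedSqKappaSignSlot_of_labelledKappaStageB omegaR mstarOfRecord amplCs
    F0P3cDyRamLabelledKappaOrbitCountZero.cast_sum_signChar_mul_ncard_inLevel_eq_eight_mul_finsum_kappaCount_zero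
    (kappaSignCount2_typeZero_sq_of_boxSum hbox) σ ϖ d t

/-- **THE ED. 5 STUB SENTENCE MODULO THE BOX-SUM** — `DyadicFence (SqKappaSignLawAtS2 shiftR omegaR depthOfRecord csOfRecord σ ϖ d t)` for every place datum, by
definitional unfolding of ★ DEFS №5's `DyadicFence` ∕ `SqKappaSignLawAtS2` ∕ `sqFixCount` against §2.  Once LH4-p10's `SqLabelledBoxSum_holds` is ★, `stub_law_sq` is paid by
`fun σ ϖ d t => dyadicFence_sqKappaSignLawAtS2_ofRecord_of_boxSum SqLabelledBoxSum_holds σ ϖ d t`. [cite: Kottwitz1986BaseChangeUnits, §1 pp. 240–241]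
[cite: Rogawski1990, §4.9 Prop. 4.9.1 (a) p. 55] -/
theorem dyadicFence_sqKappaSignLawAtS2_ofRecord_of_boxSum (hbox : Literature.Uncategorized.SqLabelledBoxSum)
    {K : Type} [Field K] [Valued K ℤᵐ⁰] [CompleteSpace K] [Fintype 𝓀[K]] (σ : K →+* K) (ϖ : K) (d t : ℕ) :
    DyadicFence (K := K) (SqKappaSignLawAtS2 shiftR omegaR depthOfRecord csOfRecord σ ϖ d t) :=
  fencedSqKappaSign_ofRecord_of_boxSum hbox σ ϖ d t


/-! ## §3  UNCONDITIONAL — fed with ★ p860095 `SqLabelledBoxSum_holds` (LH4-p10 (g6)) -/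

/-- **(S2b-κS) THE LABELLED SIGNED κ-STAGE B₀ OF THE SQUARE LAW — UNCONDITIONAL** (§1 at ★ `SqLabelledBoxSum_holds`): the binder `hBκS0sq` of ★ p859556 at
`(omegaR, mstarOfRecord, amplCs)`. [cite: Kottwitz1986BaseChangeUnits, §1 pp. 240–241] [cite: Rogawski1990, §4.9 Prop. 4.9.1 (a) p. 55; §4.10 p. 58] [cite: LanglandsShelstad1987, §3] -/
theorem kappaSignCount2_typeZero_sq :
    ∀ {K : Type} [Field K] [Valued K ℤᵐ⁰] [CompleteSpace K] [Fintype 𝓀[K]] {σ : K →+* K} {ϖ : K} {d t : ℕ}, IsRamifiedQuadraticDatum σ ϖ d t →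
      Valued.v (2 : K) < 1 → ∀ {δ : K}, σ δ = -δ → δ ≠ 0 →
      ∀ {a b : K}, a * σ a = 1 → b * σ b = 1 → Valued.v (a - 1) < Valued.v (2 : K) → Valued.v (b - 1) < Valued.v (2 : K) →
      ∀ {n₁ n₂ n₃ : ℕ}, IsElementDatum σ ϖ (depthOfRecord d) (a * a) (b * b) n₁ n₂ n₃ →
      ∀ (T : GL (Fin 3) K), (T : Matrix (Fin 3) (Fin 3) K) = Matrix.diagonal ![a * a, b * b, 1] → ∀ (k : ℕ), 2 * k + d = n₁ + n₂ + n₃ + 2 →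
      ∀ (i : Fin 3) (B : ℤ), 2 * B = ((![n₁, n₂, n₃] : Fin 3 → ℕ) i : ℤ) - d + 2 - 2 * shiftR d t →
        ∑ᶠ M ∈ {M : Submodule 𝒪[K] (Fin 3 → K) | M ∈ normalisedStableLattices T ∧ IsDualisableLattice σ ϖ M ∧
            LatticeInLevel ϖ (mstarOfRecord d) (Matrix.diagonal ![(a * a - 1) * (a * a - 1), (b * b - 1) * (b * b - 1), 0]) M},
            (kappaCount σ ϖ 0 i M : ℚ) * stabiliserWeight σ M =
          ((omegaR K σ ϖ d a b i * ((![normSign σ (-1 : K), normSign σ (-1 : K), 1] : Fin 3 → ℤ) i *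
            (baseSign σ i * normSign σ (fPartProd δ ![a, b, 1] i))) : ℤ) : ℚ) * amplCs (Fintype.card 𝓀[K]) d t k B / 4 :=
  kappaSignCount2_typeZero_sq_of_boxSum F0P3cDyRamSqLabelledKappaBoxSum.SqLabelledBoxSum_holds

/-- **THE FENCED SQUARE κ-SIGN LAW SLOT OF RECORD — UNCONDITIONAL.** [cite: Kottwitz1986BaseChangeUnits, §1 pp. 240–241] [cite: Rogawski1990, §4.9 Prop. 4.9.1 (a) p. 55] [cite: LanglandsShelstad1987, §3] -/
theorem fencedSqKappaSign_ofRecord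
    {K : Type} [Field K] [Valued K ℤᵐ⁰] [CompleteSpace K] [Fintype 𝓀[K]] (σ : K →+* K) (ϖ : K) (d t : ℕ) :
    Valued.v (2 : K) < 1 → IsRamifiedQuadraticDatum σ ϖ d t →
      ∀ (f : Fin 4 → Fin 3 → (Fin 3 → K)), IsFourFrameFamily σ f →
      ∀ (δ : K), σ δ = -δ → δ ≠ 0 →
      ∀ (a b : K), a * σ a = 1 → b * σ b = 1 → Valued.v (a - 1) < Valued.v (2 : K) → Valued.v (b - 1) < Valued.v (2 : K) →
      ∀ (n₁ n₂ n₃ : ℕ), IsElementDatum σ ϖ (depthOfRecord d) (a * a) (b * b) n₁ n₂ n₃ →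
      ∀ (Γ : Fin 4 → GL (Fin 3) K), (∀ b', (Γ b' : Matrix (Fin 3) (Fin 3) K) = frameElt σ f b' (a * a) (b * b)) →
      ∀ (k : ℕ), 2 * k + d = n₁ + n₂ + n₃ + 2 →
      ∀ (i : Fin 3) (B : ℤ), 2 * B = ((![n₁, n₂, n₃] : Fin 3 → ℕ) i : ℤ) - d + 2 - 2 * shiftR d t →
        ((∑ b' : Fin 4, kappaChar i b' * ({M : Submodule (Valued.integer K) (Fin 3 → K) | IsVertexLattice σ ϖ ((StdForm.antidiagonal 3).over K) 0 M ∧ mapGL (Γ b') M = M ∧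
            LatticeInLevel ϖ (mstarOfRecord d) (((Γ b' : Matrix (Fin 3) (Fin 3) K) - 1) * ((Γ b' : Matrix (Fin 3) (Fin 3) K) - 1)) M}.ncard : ℤ) : ℤ) : ℚ) =
          (omegaR K σ ϖ d a b i * (baseSign σ i * normSign σ (fPartProd δ ![a, b, 1] i)) : ℤ) * amplCs (Fintype.card 𝓀[K]) d t k B :=
  fencedSqKappaSign_ofRecord_of_boxSum F0P3cDyRamSqLabelledKappaBoxSum.SqLabelledBoxSum_holds σ ϖ d t

/-- **HEAD — (L-sq) THE κ-SIGNED SQUARE CENSUS LAW OF RECORD AT THE WILD RAMIFIED PLACE: `DyadicFence (SqKappaSignLawAtS2 shiftR omegaR depthOfRecord csOfRecord σ ϖ d t)` for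
every place datum — THE SENTENCE OF THE TIER-0 ED. 5 STUB `F0P3cDyRamFourFrame.stub_law_sq` BY NAME** (★ DEFS №5 `SqKappaSignLawAtS2`: `Σ_b κᵢ(b)·sqFixCount m* (Γ_b) =
omegaR_i·baseSign_i·ω(fPartProd δ (a,b,1) i)·ampl(q, k − cs d, B − cs d)` for every four-frame family, skew δ, roots under the guards, square element datum at the depth of record).
Chain: ★ p859535 (S1 transport) → ★ p859556 (S2c composition) → ★ p859612 (S2a-κ labelled κ-Stage A₀) → this file's §1 (S2b-κS: ★ p857128's dictionary over the LABELLED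
TRUNK (d) PART 4 = ★ p859743 partition + cells ★ p859990 ∕ (d) PARTS 2–3 over ★ p859711∕p859941∕p859787∕★ p859864 (LH4-p09) + the truncated box-sum ★ p859958 ∕ ★ p860095
(LH4-p10)).  Pay line: `stub_law_sq := fun σ ϖ d t => dyadicFence_sqKappaSignLawAtS2_ofRecord σ ϖ d t`. [cite: Kottwitz1986BaseChangeUnits, §1 pp. 240–241]
[cite: Rogawski1990, §4.9 Prop. 4.9.1 (a) p. 55; §4.10 p. 58] [cite: LanglandsShelstad1987, §1.3, §3] -/
theorem dyadicFence_sqKappaSignLawAtS2_ofRecord {K : Type} [Field K] [Valued K ℤᵐ⁰] [CompleteSpace K] [Fintype 𝓀[K]] (σ : K →+* K) (ϖ : K) (d t : ℕ) :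
    DyadicFence (K := K) (SqKappaSignLawAtS2 shiftR omegaR depthOfRecord csOfRecord σ ϖ d t) :=
  dyadicFence_sqKappaSignLawAtS2_ofRecord_of_boxSum F0P3cDyRamSqLabelledKappaBoxSum.SqLabelledBoxSum_holds σ ϖ d t

end Summit.HodgeConjecture.HodgeConjecture.Cruxes.H413.F0P3cDyRamSqKappaSignLawOfBoxSum

end
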